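import Literature.Barriers.CriticalPhenomena.SupercriticalSAWSpaceFillingTilesPieces
import HarnessLib

/-!
# Supercritical SAW (Duminil-Copin–Kozma–Yadin 2014), Theorem 6 for the disk via odd tiles:
# the union bound

The Peierls sum of the proof of Theorem 6 of H. Duminil-Copin, G. Kozma, A. Yadin,
*Supercritical self-avoiding walks are space-filling*, Ann. IHP Probab. Stat. 50 (2014), §3
("`P[𝒜(s)] ≤ Σ_{F ∈ 𝓕(Ω_δ,ξ) : |F| ≥ s/(2m+1)²} C(x,m) [Z_m(x)]^{-|F|}`"), in the tile form:
`lawAt_hasLargeHole_le_sums` bounds the law of `HasLargeHole ξ s` by the sum of the main pieces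
over `t' ∈ deepTiles`, directions, sizes `N ∈ [⌊s/C₃⌋+1, #deepTiles]`, connected families and
radii, plus the sum of the annular pieces over radii `d₀ ∈ [ρ+1, 2⌈1/δ⌉]` and the eight frames
(`hasLargeHole_subset`, countable subadditivity, `lawAt_mainPiece_le`, `lawAt_annPiece_le`),
and `mainSum_le`, `annSum_le` evaluate the two sums: the main one is at most
`#deepTiles · 4 · L · Σ_N 25^{N-1} bMain N` (`card_famT_le`), the annular one at most
`8 (2⌈1/δ⌉ + 1) · max_{d₀} bAnn` with the half-disk families of size `≥ M²`.
-/

noncomputable section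

open MeasureTheory Finset Literature.Probability.LatticeModels Literature.Probability.Percolation
  Literature.Probability.RandomPlanarGeometry.SAW
open scoped ENNReal

namespace Literature.Barriers.CriticalPhenomena

namespace SupercriticalSAW

variable {m r : ℕ} {δ : ℝ} {u v : Site 2}

/-- The sum of the main pieces. [cite: DuminilCopinKozmaYadin2014, §3 (proof of Theorem 6: "P[𝒜(s)] ≤ Σ_{F ∈ 𝓕(Ω_δ,ξ) : |F| ≥ s/(2m+1)²} C(x,m) [Z_m(x)]^{-|F|}")] -/
def mainSum (m r : ℕ) (δ : ℝ) (x s : ℝ) : ℝ :=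
  ∑ t' ∈ deepTiles δ m r (RdP m r), ∑ dp : Dir,
    ∑ N ∈ Finset.Icc (⌊s / C3P m r⌋₊ + 1) (deepTiles δ m r (RdP m r)).card,
      ∑ _𝒞 ∈ (famT δ m r (RdP m r) (t' + dp.vec) N).filter (fun 𝒞 => t' ∉ 𝒞),
        ∑ _d₀ ∈ Finset.Icc ((rhoP m r : ℤ) - OddTile.side m r + 1) (rhoP m r), bMain m r x N

/-- The sum of the annular pieces. [cite: DuminilCopinKozmaYadin2014, §3 (proof of Theorem 6)] -/
def annSum (m r : ℕ) (δ : ℝ) (x : ℝ) : ℝ :=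
  ∑ d₀ ∈ Finset.Icc ((rhoP m r : ℤ) + 1) (2 * ⌈1 / δ⌉₊), ∑ G ∈ framesAt 0,
    bAnn m r x d₀ (halfFamily δ m r (RdP m r) G).card

/-- The main pieces are non-negative. [folklore] -/
theorem bMain_nonneg {x : ℝ} (hx : 0 < x) (hZ : 0 < Zbox m x) (N : ℕ) : 0 ≤ bMain m r x N := by
  unfold bMain; positivity

/-- The annular pieces are non-negative (for `d₀ ≥ 0`). [folklore] -/
theorem bAnn_nonneg {x : ℝ} (hx : 0 < x) (hZ : 0 < Zbox m x) {d₀ : ℤ} (hd : 0 ≤ d₀) (N : ℕ) : 0 ≤ bAnn m r x d₀ N := by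
  have : (0 : ℝ) ≤ d₀ := by exact_mod_cast hd
  unfold bAnn; positivity

/-- **The union bound.** For `0 < δ ≤ min(1/10, 1/K²)`, `s ≥ 0`, closest-site endpoints `≥ 10`
apart, and all tiles with `|τ|_∞ ≤ M` deep (`M ≥ 1`), the law of `HasLargeHole ξ s` is at most
`mainSum + annSum`. [cite: DuminilCopinKozmaYadin2014, §3 (proof of Theorem 6: "P[𝒜(s)] ≤ Σ_{F ∈ 𝓕(Ω_δ,ξ) : |F| ≥ s/(2m+1)²} C(x,m) [Z_m(x)]^{-|F|}")] -/
theorem lawAt_hasLargeHole_le_sums (hδ : 0 < δ) (hδ' : δ ≤ 1 / 10) (hδK : δ ≤ 1 / (KP m r : ℝ) ^ 2)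
    (hr : 4 ≤ r) {x : ℝ} (hx : 0 < x) (hZ : 0 < Zbox m x) {a b : ℂ} (ha : ‖a‖ = 1) (hb : ‖b‖ = 1)
    (hu : IsClosestSite unitDisk δ a u) (hv : IsClosestSite unitDisk δ b v) (huv : 10 ≤ l1dist u v)
    {M : ℕ} (hM : 1 ≤ M) (hdeepM : ∀ τ : Site 2, (∀ k, |τ k| ≤ M) → IsDeepTile δ m r (RdP m r) τ)
    {s : ℝ} (hs : 0 ≤ s) :
    lawAt x unitDisk δ u v {γ | HasLargeHole (xiP m r) s γ} ≤
      ENNReal.ofReal (mainSum m r δ x s + annSum m r δ x) := by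
  classical
  have hδ4 : δ ≤ 1 / 4 := hδ'.trans (by norm_num)
  set P := lawAt x unitDisk δ u v with hP
  obtain ⟨p1, p2, p3, p4, p5⟩ := params_bounds m r
  -- piece bounds
  have hmain : ∀ t' ∈ deepTiles δ m r (RdP m r), ∀ dp : Dir, ∀ N : ℕ,
      ∀ 𝒞 ∈ (famT δ m r (RdP m r) (t' + dp.vec) N).filter (fun 𝒞 => t' ∉ 𝒞),
      ∀ d₀ ∈ Finset.Icc ((rhoP m r : ℤ) - OddTile.side m r + 1) (rhoP m r),
      P {γ | γ.walk.support ∈ mainEvent m r δ u v (rhoP m r) 𝒞 t' d₀} ≤ ENNReal.ofReal (bMain m r x N) := by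
    intro t' ht' dp N 𝒞 h𝒞 d₀ hd₀
    rw [Finset.mem_filter, mem_famT] at h𝒞
    obtain ⟨⟨hsub, hcard, ht, hconn⟩, ht'𝒞⟩ := h𝒞
    rw [Finset.mem_Icc] at hd₀
    rw [← hcard]
    exact lawAt_mainPiece_le hδ hδ4 hr hx hZ ha hb hu hv huv hsub hconn ht'𝒞 ((mem_deepTiles hδ).1 ht') ht hd₀
  have hann : ∀ d₀ ∈ Finset.Icc ((rhoP m r : ℤ) + 1) (2 * ⌈1 / δ⌉₊), ∀ G ∈ framesAt (0 : Site 2),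
      P {γ | γ.walk.support ∈ annEvent m r δ u v (rhoP m r) (RdP m r) d₀ G} ≤
        ENNReal.ofReal (bAnn m r x d₀ (halfFamily δ m r (RdP m r) G).card) := by
    intro d₀ hd₀ G hG
    rw [Finset.mem_Icc] at hd₀
    have hGz : G.z₀ = 0 := z₀_of_mem_framesAt hG
    exact lawAt_annPiece_le hδ hδ' hr hx hZ ha hb hu hv huv hM hdeepM hd₀.1 hGz
  -- the covering and subadditivity
  have hcover := hasLargeHole_subset (m := m) (r := r) (v := v) hδ hδK hu.1 hs
  refine (measure_mono hcover).trans ((measure_union_le _ _).trans ?_)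
  rw [ENNReal.ofReal_add (by
      unfold mainSum
      exact Finset.sum_nonneg fun _ _ => Finset.sum_nonneg fun _ _ => Finset.sum_nonneg fun _ _ =>
        Finset.sum_nonneg fun _ _ => Finset.sum_nonneg fun _ _ => bMain_nonneg hx hZ _)
    (by
      unfold annSum
      exact Finset.sum_nonneg fun d₀ hd₀ => Finset.sum_nonneg fun _ _ =>
        bAnn_nonneg hx hZ (by rw [Finset.mem_Icc] at hd₀; omega) _)]
  refine add_le_add ?_ ?_
  · -- the main sum
    calc P (⋃ t' ∈ deepTiles δ m r (RdP m r), ⋃ dp : Dir,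
          ⋃ N ∈ Finset.Icc (⌊s / C3P m r⌋₊ + 1) (deepTiles δ m r (RdP m r)).card,
          ⋃ 𝒞 ∈ (famT δ m r (RdP m r) (t' + dp.vec) N).filter (fun 𝒞 => t' ∉ 𝒞),
          ⋃ d₀ ∈ Finset.Icc ((rhoP m r : ℤ) - OddTile.side m r + 1) (rhoP m r),
            {γ | γ.walk.support ∈ mainEvent m r δ u v (rhoP m r) 𝒞 t' d₀})
        ≤ ∑ t' ∈ deepTiles δ m r (RdP m r), ∑ dp : Dir,
            ∑ N ∈ Finset.Icc (⌊s / C3P m r⌋₊ + 1) (deepTiles δ m r (RdP m r)).card,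
            ∑ 𝒞 ∈ (famT δ m r (RdP m r) (t' + dp.vec) N).filter (fun 𝒞 => t' ∉ 𝒞),
            ∑ d₀ ∈ Finset.Icc ((rhoP m r : ℤ) - OddTile.side m r + 1) (rhoP m r),
              P {γ | γ.walk.support ∈ mainEvent m r δ u v (rhoP m r) 𝒞 t' d₀} := by
          refine (measure_biUnion_finset_le _ _).trans (Finset.sum_le_sum fun t' _ => ?_)
          refine (measure_iUnion_fintype_le _ _).trans (Finset.sum_le_sum fun dp _ => ?_)
          refine (measure_biUnion_finset_le _ _).trans (Finset.sum_le_sum fun N _ => ?_)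
          refine (measure_biUnion_finset_le _ _).trans (Finset.sum_le_sum fun 𝒞 _ => ?_)
          exact measure_biUnion_finset_le _ _
      _ ≤ ∑ t' ∈ deepTiles δ m r (RdP m r), ∑ dp : Dir,
            ∑ N ∈ Finset.Icc (⌊s / C3P m r⌋₊ + 1) (deepTiles δ m r (RdP m r)).card,
            ∑ 𝒞 ∈ (famT δ m r (RdP m r) (t' + dp.vec) N).filter (fun 𝒞 => t' ∉ 𝒞),
            ∑ d₀ ∈ Finset.Icc ((rhoP m r : ℤ) - OddTile.side m r + 1) (rhoP m r),
              ENNReal.ofReal (bMain m r x N) := by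
          refine Finset.sum_le_sum fun t' ht' => Finset.sum_le_sum fun dp _ => Finset.sum_le_sum fun N _ =>
            Finset.sum_le_sum fun 𝒞 h𝒞 => Finset.sum_le_sum fun d₀ hd₀ => ?_
          exact hmain t' ht' dp N 𝒞 h𝒞 d₀ hd₀
      _ = ENNReal.ofReal (mainSum m r δ x s) := by
          unfold mainSum
          rw [ENNReal.ofReal_sum_of_nonneg fun _ _ => Finset.sum_nonneg fun _ _ => Finset.sum_nonneg fun _ _ =>
            Finset.sum_nonneg fun _ _ => Finset.sum_nonneg fun _ _ => bMain_nonneg hx hZ _]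
          refine Finset.sum_congr rfl fun t' _ => ?_
          rw [ENNReal.ofReal_sum_of_nonneg fun _ _ => Finset.sum_nonneg fun _ _ =>
            Finset.sum_nonneg fun _ _ => Finset.sum_nonneg fun _ _ => bMain_nonneg hx hZ _]
          refine Finset.sum_congr rfl fun dp _ => ?_
          rw [ENNReal.ofReal_sum_of_nonneg fun _ _ => Finset.sum_nonneg fun _ _ =>
            Finset.sum_nonneg fun _ _ => bMain_nonneg hx hZ _]
          refine Finset.sum_congr rfl fun N _ => ?_
          rw [ENNReal.ofReal_sum_of_nonneg fun _ _ => Finset.sum_nonneg fun _ _ => bMain_nonneg hx hZ _]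
          refine Finset.sum_congr rfl fun 𝒞 _ => ?_
          rw [ENNReal.ofReal_sum_of_nonneg fun _ _ => bMain_nonneg hx hZ _]
  · -- the annular sum
    calc P (⋃ d₀ ∈ Finset.Icc ((rhoP m r : ℤ) + 1) (2 * ⌈1 / δ⌉₊), ⋃ G ∈ framesAt 0,
          {γ | γ.walk.support ∈ annEvent m r δ u v (rhoP m r) (RdP m r) d₀ G})
        ≤ ∑ d₀ ∈ Finset.Icc ((rhoP m r : ℤ) + 1) (2 * ⌈1 / δ⌉₊), ∑ G ∈ framesAt 0,
            P {γ | γ.walk.support ∈ annEvent m r δ u v (rhoP m r) (RdP m r) d₀ G} := by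
          refine (measure_biUnion_finset_le _ _).trans (Finset.sum_le_sum fun d₀ _ => ?_)
          exact measure_biUnion_finset_le _ _
      _ ≤ ∑ d₀ ∈ Finset.Icc ((rhoP m r : ℤ) + 1) (2 * ⌈1 / δ⌉₊), ∑ G ∈ framesAt 0,
            ENNReal.ofReal (bAnn m r x d₀ (halfFamily δ m r (RdP m r) G).card) :=
          Finset.sum_le_sum fun d₀ hd₀ => Finset.sum_le_sum fun G hG => hann d₀ hd₀ G hG
      _ = ENNReal.ofReal (annSum m r δ x) := by
          unfold annSum
          rw [ENNReal.ofReal_sum_of_nonneg fun d₀ hd₀ => Finset.sum_nonneg fun _ _ =>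
            bAnn_nonneg hx hZ (by rw [Finset.mem_Icc] at hd₀; omega) _]
          refine Finset.sum_congr rfl fun d₀ hd₀ => ?_
          rw [ENNReal.ofReal_sum_of_nonneg fun _ _ => bAnn_nonneg hx hZ (by rw [Finset.mem_Icc] at hd₀; omega) _]

/-! ### Evaluation of the two sums -/

/-- **The main sum**: at most `#deepTiles · 4 · L · Σ_{N} 25^{N-1} bMain N`.
[cite: DuminilCopinKozmaYadin2014, §3 (proof of Theorem 6: "the number of families of connected boxes of size K … is bounded by (C(Ω)/δ²) λ^K")] -/
theorem mainSum_le {x : ℝ} (hx : 0 < x) (hZ : 0 < Zbox m x) (s : ℝ) :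
    mainSum m r δ x s ≤ (deepTiles δ m r (RdP m r)).card * (4 * (OddTile.side m r *
      ∑ N ∈ Finset.Icc (⌊s / C3P m r⌋₊ + 1) (deepTiles δ m r (RdP m r)).card, (25 : ℝ) ^ (N - 1) * bMain m r x N)) := by
  classical
  unfold mainSum
  have hL : ∀ (ρ : ℤ), ((Finset.Icc (ρ - OddTile.side m r + 1) ρ).card : ℝ) = OddTile.side m r := by
    intro ρ; rw [Int.card_Icc]; norm_cast; omega
  have inner : ∀ (t' : Site 2) (dp : Dir),
      ∑ N ∈ Finset.Icc (⌊s / C3P m r⌋₊ + 1) (deepTiles δ m r (RdP m r)).card,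
        ∑ 𝒞 ∈ (famT δ m r (RdP m r) (t' + dp.vec) N).filter (fun 𝒞 => t' ∉ 𝒞),
          ∑ d₀ ∈ Finset.Icc ((rhoP m r : ℤ) - OddTile.side m r + 1) (rhoP m r), bMain m r x N ≤
      OddTile.side m r * ∑ N ∈ Finset.Icc (⌊s / C3P m r⌋₊ + 1) (deepTiles δ m r (RdP m r)).card,
        (25 : ℝ) ^ (N - 1) * bMain m r x N := by
    intro t' dp
    rw [Finset.mul_sum]
    refine Finset.sum_le_sum fun N _ => ?_
    simp only [Finset.sum_const, nsmul_eq_mul, hL]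
    have hfam : (((famT δ m r (RdP m r) (t' + dp.vec) N).filter fun 𝒞 => t' ∉ 𝒞).card : ℝ) ≤ (25 : ℝ) ^ (N - 1) := by
      have := (Finset.card_filter_le (famT δ m r (RdP m r) (t' + dp.vec) N) (fun 𝒞 => t' ∉ 𝒞)).trans
        (card_famT_le (δ := δ) (m := m) (r := r) (RdP m r) (t' + dp.vec) N)
      exact_mod_cast this
    have hb := bMain_nonneg (m := m) (r := r) hx hZ N
    calc ((((famT δ m r (RdP m r) (t' + dp.vec) N).filter fun 𝒞 => t' ∉ 𝒞).card : ℝ)) *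
          ((OddTile.side m r : ℝ) * bMain m r x N)
        ≤ (25 : ℝ) ^ (N - 1) * ((OddTile.side m r : ℝ) * bMain m r x N) :=
          mul_le_mul_of_nonneg_right hfam (by positivity)
      _ = _ := by ring
  calc ∑ t' ∈ deepTiles δ m r (RdP m r), ∑ dp : Dir,
        ∑ N ∈ Finset.Icc (⌊s / C3P m r⌋₊ + 1) (deepTiles δ m r (RdP m r)).card,
          ∑ 𝒞 ∈ (famT δ m r (RdP m r) (t' + dp.vec) N).filter (fun 𝒞 => t' ∉ 𝒞),
            ∑ d₀ ∈ Finset.Icc ((rhoP m r : ℤ) - OddTile.side m r + 1) (rhoP m r), bMain m r x N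
      ≤ ∑ t' ∈ deepTiles δ m r (RdP m r), ∑ dp : Dir, (OddTile.side m r *
          ∑ N ∈ Finset.Icc (⌊s / C3P m r⌋₊ + 1) (deepTiles δ m r (RdP m r)).card, (25 : ℝ) ^ (N - 1) * bMain m r x N) :=
        Finset.sum_le_sum fun t' _ => Finset.sum_le_sum fun dp _ => inner t' dp
    _ = _ := by
        simp only [Finset.sum_const, Finset.card_univ, nsmul_eq_mul]
        have : (Fintype.card Dir : ℝ) = 4 := by rfl
        rw [this]

/-- **The annular sum**: each piece is at most the piece at the largest radius with a family of
`M²` tiles (when the half-disk families have at least `M²` tiles and `x^{4r+2} Z_m(x) ≥ 1`), and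
there are at most `8 (2⌈1/δ⌉ + 1)` of them. [folklore] -/
theorem annSum_le {x : ℝ} (hδ : 0 < δ) (hx : 0 < x) (hZ : 0 < Zbox m x) (hY : 1 ≤ x ^ (4 * r + 2) * Zbox m x)
    {M : ℕ} (hMF : ∀ G ∈ framesAt (0 : Site 2), M ^ 2 ≤ (halfFamily δ m r (RdP m r) G).card) (hM : 1 ≤ M) :
    annSum m r δ x ≤ 8 * ((2 * ⌈1 / δ⌉₊ + 1 : ℕ) : ℝ) *
      (80 * ((2 * ⌈1 / δ⌉₊ : ℕ) + 1 : ℝ) * max 1 x⁻¹ ^ (10 * (2 * ⌈1 / δ⌉₊) + 3) /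
        (Zbox m x * (x ^ (4 * r + 2) * Zbox m x) ^ (M ^ 2 - 1))) := by
  classical
  set D : ℕ := 2 * ⌈1 / δ⌉₊ with hD
  set B : ℝ := 80 * ((D : ℝ) + 1) * max 1 x⁻¹ ^ (10 * D + 3) / (Zbox m x * (x ^ (4 * r + 2) * Zbox m x) ^ (M ^ 2 - 1))
    with hB
  have hmax : (1 : ℝ) ≤ max 1 x⁻¹ := le_max_left _ _
  -- each piece is at most `B`
  have hpiece : ∀ d₀ ∈ Finset.Icc ((rhoP m r : ℤ) + 1) (D : ℤ), ∀ G ∈ framesAt (0 : Site 2),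
      bAnn m r x d₀ (halfFamily δ m r (RdP m r) G).card ≤ B := by
    intro d₀ hd₀ G hG
    rw [Finset.mem_Icc] at hd₀
    set N := (halfFamily δ m r (RdP m r) G).card with hN
    have hNM : M ^ 2 ≤ N := hMF G hG
    have hN1 : 1 ≤ N := le_trans (by nlinarith) hNM
    have hd0 : (0 : ℝ) ≤ d₀ := by exact_mod_cast (show (0 : ℤ) ≤ d₀ by omega)
    have hdD : (d₀ : ℝ) ≤ D := by exact_mod_cast hd₀.2
    -- rewrite the denominator as `Zbox · Y^{N-1}`
    have hden : x ^ ((4 * r + 2) * (N - 1)) * Zbox m x ^ N = Zbox m x * (x ^ (4 * r + 2) * Zbox m x) ^ (N - 1) := by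
      obtain ⟨k, hk⟩ : ∃ k, N = k + 1 := ⟨N - 1, by omega⟩
      rw [hk, Nat.add_sub_cancel, pow_succ, mul_pow, ← pow_mul]
      ring
    rw [bAnn, hden, hB]
    have hnum : 80 * ((d₀ : ℝ) + 1) * max 1 x⁻¹ ^ (10 * d₀ + 3).toNat ≤ 80 * ((D : ℝ) + 1) * max 1 x⁻¹ ^ (10 * D + 3) :=
      mul_le_mul (by linarith) (pow_le_pow_right₀ hmax (by omega)) (by positivity) (by positivity)
    have hdenle : Zbox m x * (x ^ (4 * r + 2) * Zbox m x) ^ (M ^ 2 - 1) ≤ Zbox m x * (x ^ (4 * r + 2) * Zbox m x) ^ (N - 1) :=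
      mul_le_mul_of_nonneg_left (pow_le_pow_right₀ hY (by omega)) hZ.le
    exact div_le_div₀ (by positivity) hnum (by positivity) hdenle
  unfold annSum
  calc ∑ d₀ ∈ Finset.Icc ((rhoP m r : ℤ) + 1) (D : ℤ), ∑ G ∈ framesAt 0, bAnn m r x d₀ (halfFamily δ m r (RdP m r) G).card
      ≤ ∑ d₀ ∈ Finset.Icc ((rhoP m r : ℤ) + 1) (D : ℤ), ∑ G ∈ framesAt (0 : Site 2), B :=
        Finset.sum_le_sum fun d₀ hd₀ => Finset.sum_le_sum fun G hG => hpiece d₀ hd₀ G hG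
    _ ≤ 8 * ((D + 1 : ℕ) : ℝ) * B := by
        simp only [Finset.sum_const, nsmul_eq_mul]
        have hB0 : 0 ≤ B := by rw [hB]; positivity
        have h1 : ((framesAt (0 : Site 2)).card : ℝ) ≤ 8 := by exact_mod_cast card_framesAt_le 0
        have h2 : ((Finset.Icc ((rhoP m r : ℤ) + 1) (D : ℤ)).card : ℝ) ≤ ((D + 1 : ℕ) : ℝ) := by
          rw [Int.card_Icc]
          have : ((D : ℤ) + 1 - ((rhoP m r : ℤ) + 1)).toNat ≤ D + 1 := Int.toNat_le.2 (by push_cast; omega)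
          exact_mod_cast this
        calc ((Finset.Icc ((rhoP m r : ℤ) + 1) (D : ℤ)).card : ℝ) * (((framesAt (0 : Site 2)).card : ℝ) * B)
            ≤ ((D + 1 : ℕ) : ℝ) * (8 * B) :=
              mul_le_mul h2 (mul_le_mul_of_nonneg_right h1 hB0) (by positivity) (by positivity)
          _ = _ := by ring

end SupercriticalSAW

end Literature.Barriers.CriticalPhenomena
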